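import Literature.MathematicalPhysics.QuantumFieldTheory.Balaban1983to89.B9Eq3132DecayFromMajorant

/-!
# `Balaban1983to89.B9Eq3132StepDifference` — T. Bałaban, *Propagators for lattice gauge theories in a background field*, Commun. Math. Phys. **99** (1985)
# 389–434 [Balaban1985BackgroundPropagators], (3.130) p. 421 ∕ (3.138) p. 423 under Theorem 3.12's prefix: THE [4]-(2.51) MAJORANTS OF `G_D − G₀` AND `G₁ − G₀`
# CARRYING THE SMALL FACTOR `Mα₀` (ROW 20's displayed steps and identities), AND THE Λ-NORMALISED ENTRY OF `Q T(U) Q*` FROM A BLOCK MAJORANT WITH AN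
# EXPLICIT CONSTANT — part 1 of the row-26 coercivity transfer (part 2: `B9Eq3132CoerciveFromGA`)

[4] = T. Bałaban, *Propagators and renormalization transformations for lattice gauge theories. II*, Commun. Math. Phys. **96** (1984) 223–250 [`Balaban1984PropagatorsII`].

statement-level skeleton of published theorems with citation tags; proofs where landed; nothing here is a claim about the Yang–Mills mass gap

THE PRINT.  [B9] p. 421: *«Let us denote for a moment the operator we have investigated in previous sections by G₀, i.e. G₀ = (Δ + DRD* + Q*aQ)⁻¹.
From (3.120) we get G = G₀(I − Δ′_πG₀)⁻¹ = Σ_{n=0}^∞ G₀(Δ′_πG₀)ⁿ. (3.130)»*; p. 422: *«This inequality [(3.131)] and Theorem 3.3 for G₀ imply a convergence of the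
series (3.130), for α₀ sufficiently small … each operator Δ′_π provides the small factor α₀»*; p. 423 (3.138) *«G₁ = G₀(I − (Δ′_π + Δ⁽²⁾_π)G₀)⁻¹»* and Theorem 3.12
(prefix: (3.35), (3.36), α₀ small); [4] (2.51) p. 232, (2.142) p. 248, Lemma 2.1 (2.60)–(2.61) p. 234.

WHY THIS FILE (dag-n06-i gen 13, N06 bundle F4, row 26).  The certificate of record `…N06AtOpsYNuOfRecordV6EPairML2` displays for ROW 26 the two COERCIVITY
binders `hco26 ∕ hco₁26` (Λ²-coercivity of the normalised `Q G_D(U) Q*`, `Q G₁(U) Q*`), and for ROW 20 `hmodel12`, whose (3.131)∕(3.137) STEPS (block majorant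
`θ₁(Mα₀)·e^{−δ_K d}` of `G₀Δ′_π`, `G₀(Δ′_π + Δ⁽²⁾_π)` in the state norm 𝔠⁽²⁾) and IDENTITIES (`G₀Δ_a = 1`, `(Δ_a − Δ′_π)G = 1`, `(Δ_a − Δ′_π − Δ⁽²⁾_π)G₁ = 1`) give
`G − G₀ = G₀Δ′_πG`, `G₁ − G₀ = G₀(Δ′_π + Δ⁽²⁾_π)G₁` [4]-(2.51) majorants that CARRY THE SMALL FACTOR `Mα₀` — the input of the perturbation route (§7.2 of the cell's
written repair `QGQ-inverse-proof.md`) by which the sequel transfers the coercivity of `Q G₀(U) Q*` (`G₀ = Δ_a⁻¹`, the genuine Sect. A–C letter) to row 26's two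
matrices.  This file is the majorant half and the one-configuration entry bound with its constant explicit (gen 12's `decayUnder_QGQOfY_of_majorants` hides it in `∃B`).

WHAT IS PROVED (sorry-free; bookkeeping over landed objects).
* §1 `hasMajorant_G0TA_of_step` (one member, one `U`: the majorant `θ·B′·c·(Lʲη)²e^{−ρd}` of `G₀TA` from the step, a majorant of `A` and (2.61) — n06-l's state
  norms + `B11SectG.hasMaj_comp_exp`), `hasMajorant_sub_of_fix` (`A − G₀` under `A = G₀ + G₀TA`).
* §2 ★ `subMajorants_of_step12` (the family: majorants `(C·Mα₀)(Lʲη)²e^{−ρd}` of the coordinate models of `G_D − G₀` AND `G₁ − G₀` from the certificate's `hmodel`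
  5-conjunct shape at the pins `hblk hGco hG1co` and the NEW pin `hG0co : (𝔬 x).G0 U = GcoK … (T₀ x) U` — row 20's `G₀` IS the genuine letter `(𝔏 x).GA`).
* §3 linearity: `GcoK_sub`, `QGQOfY_sub`, `normMatY_sub`.
* §4 ★ `abs_normMatY_QGQOfY_le_of_hasMajorant` (one member, one `U`, EXPLICIT constant: the normalised entry from a block majorant — gen 12's
  (2.142)-at-`U` `norm_QGQOfY_deltaY_le` + `abs_normMatY_le` + (2.60) `levelFactor_le`).

HONEST SCOPE.  Theorem 3.3 for `G₀`, (3.131), (3.137) and the identities remain ROW 20's displayed hypotheses of printed shape; nothing of [B9] or [4] is asserted;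
count-neutral; N06 NOT discharged; one finite 𝕋^{d+1} programme at fixed ε — nothing continuum, nothing OS, nothing about the mass gap.  Cell `pub-ymgap` (HUMAN
RULING D-0062), Track A node N06 [B9], seat `pub-ymgap-dag-n06-i` (gen 13), 2026-08-27; a NEW file.
-/

noncomputable section

namespace Literature.MathematicalPhysics.QuantumFieldTheory.Balaban1983to89.B9Eq3132StepDifference

open B6RandomWalk (HasMajorant hasMajorant_mono)
open B6RandomWalkHom (hasMajorantHom_iff)
open B9CoReadingCoords (XBK blkBK GcoK coordOpK coordOpK_apply)
open B9Thm39ReadingCoords (basisBound39 cR39)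
open B6Ineq2142KLevelV1 (lvl β)
open B9Eq3132Ineq2142Covariant (norm_QGQOfY_deltaY_le abs_normMatY_le levelFactor_le)
open B9Eq3132DecayFromMajorant (norm_basis_le hasMajorant_G_G1_of_step)

variable {𝔸 : Type} [NormedRing 𝔸] [NormedAlgebra ℂ 𝔸]

/-! ## §1 One member, one configuration: the majorant of `G₀TA` and of `A − G₀` from the step -/

section OneMember

open B9Thm312Whole (Ops Thm33G0 Step FormSmall Identities GeoOK cNorm cNorm_κ wt)
open B9Thm312WholeLeaf (fix_of_inverses hasMaj_cNorm_of_hasMaj hasMajorantHom_of_hasMaj_cNorm)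
open B9Thm34Ext (toB6)
open B11SectG (RowSum HasMaj BlockNorm hasMaj_of_hasMajorant hasMaj_comp_exp)
open B6RandomWalk (Triangle254)

variable {g : B9.Geometry} {X : Type} [Fintype X] [Fintype g.Site]

/-- **THE MAJORANT OF `G₀TA`** (one member, one `U`): if the step `G₀T` has the block majorant `θe^{−δ_K d}` in the state norm 𝔠⁽²⁾ ((3.131) + Theorem 3.3 for
`G₀`, ROW 20's `Step … 2`), `A` has the [4]-(2.51) majorant `B′(Lʲη)²e^{−ρ_A d}` and (2.61) holds at rate `σ` with constant `c`, then for `ρ ≤ ρ_A`, `ρ + σ ≤ δ_K`: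
`G₀TA` has the majorant `θB′c·(Lʲη)²e^{−ρd}` — the small factor `θ = O(1)Mα₀` of p. 422 survives. [cite: Balaban1985BackgroundPropagators, (3.130)–(3.131) pp.421–422; Balaban1984PropagatorsII, (2.51) p.232, Lemma 2.1 (2.61) p.234] -/
theorem hasMajorant_G0TA_of_step {R₀ : ℝ} {H₀ : Prop} (hG : GeoOK g) {blk : X → g.Site} {G0 T A : Module.End ℝ (X → ℝ)}
    {θ B' δK ρA ρ σ c : ℝ} (hrow : RowSum (toB6 g R₀ H₀) σ c)
    (hθ : 0 ≤ θ) (hB' : 0 ≤ B') (hρ : 0 ≤ ρ) (hρA : ρ ≤ ρA) (hρδ : ρ + σ ≤ δK)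
    (hK : HasMaj (cNorm R₀ H₀ blk hG.lenle 2) (cNorm R₀ H₀ blk hG.lenle 2) (G0 ∘ₗ T)
      (fun a b => θ * Real.exp (-(δK * g.dist a b))))
    (hA : HasMajorant (g := toB6 g R₀ H₀) blk A (fun a b => B' * g.len a ^ 2 * Real.exp (-(ρA * g.dist a b)))) :
    HasMajorant (g := toB6 g R₀ H₀) blk ((G0 ∘ₗ T) ∘ₗ A) (fun a b => θ * B' * c * g.len a ^ 2 * Real.exp (-(ρ * g.dist a b))) := by
  -- `A` in the state norms: 𝔠⁽⁰⁾ → 𝔠⁽²⁾ with the constant majorant `B′e^{−ρ_A d}`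
  have h0 : HasMaj (BlockNorm.ofBlocks (toB6 g R₀ H₀) blk) (BlockNorm.ofBlocks (toB6 g R₀ H₀) blk) A
      (fun a b => B' * g.len a ^ 2 * Real.exp (-(ρA * g.dist a b))) :=
    hasMaj_of_hasMajorant (g := toB6 g R₀ H₀) blk (fun a b => mul_nonneg (mul_nonneg hB' (sq_nonneg _)) (Real.exp_nonneg _)) hA
  have hS : HasMaj (cNorm R₀ H₀ blk hG.lenle 0) (cNorm R₀ H₀ blk hG.lenle 2) A (fun a b => B' * Real.exp (-(ρA * g.dist a b))) := by
    refine (hasMaj_cNorm_of_hasMaj hG 2 0 h0).mono fun y y' => le_of_eq ?_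
    have hy : g.len y ^ 2 ≠ 0 := pow_ne_zero 2 (hG.lenpos y).ne'
    simp only [wt, pow_zero, mul_one]
    rw [mul_assoc B', mul_comm (g.len y ^ 2), ← mul_assoc B', mul_assoc, mul_inv_cancel₀ hy, mul_one]
  have htri : Triangle254 (toB6 g R₀ H₀) := fun a b c => hG.tri a b c
  have hcomp := hasMaj_comp_exp (b₁ := cNorm R₀ H₀ blk hG.lenle 0) (b₂ := cNorm R₀ H₀ blk hG.lenle 2) (b₃ := cNorm R₀ H₀ blk hG.lenle 2)
    (T₁ := G0 ∘ₗ T) (T₂ := A) htri hG.dnn hrow hθ hB' hρ hρA hρδ hK hS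
  have hnn : ∀ a b : g.Site, 0 ≤ (cNorm R₀ H₀ blk hG.lenle 2 (X := X)).κ * θ * B' * c * Real.exp (-(ρ * g.dist a b)) := by
    intro a b
    have hc : 0 ≤ c := hrow.nonneg a
    simp only [cNorm_κ, one_mul]
    positivity
  have h' := hasMajorantHom_of_hasMaj_cNorm hG hnn hcomp
  rw [hasMajorantHom_iff] at h'
  refine hasMajorant_mono (g := toB6 g R₀ H₀) blk h' fun a b => le_of_eq ?_
  simp only [wt, cNorm_κ, pow_zero, inv_one, mul_one, one_mul]
  ring

/-- **THE MAJORANT OF `A − G₀`** under the resolvent identity `A = G₀ + G₀TA` ((3.130): `G − G₀ = G₀Δ′_πG`; (3.138): `G₁ − G₀ = G₀(Δ′_π + Δ⁽²⁾_π)G₁`):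
the majorant of §1's `G₀TA`. [cite: Balaban1985BackgroundPropagators, (3.130) p.421, (3.138) p.423; Balaban1984PropagatorsII, (2.51) p.232] -/
theorem hasMajorant_sub_of_fix {R₀ : ℝ} {H₀ : Prop} (hG : GeoOK g) {blk : X → g.Site} {G0 T A : Module.End ℝ (X → ℝ)}
    {θ B' δK ρA ρ σ c : ℝ} (hrow : RowSum (toB6 g R₀ H₀) σ c)
    (hθ : 0 ≤ θ) (hB' : 0 ≤ B') (hρ : 0 ≤ ρ) (hρA : ρ ≤ ρA) (hρδ : ρ + σ ≤ δK)
    (hK : HasMaj (cNorm R₀ H₀ blk hG.lenle 2) (cNorm R₀ H₀ blk hG.lenle 2) (G0 ∘ₗ T)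
      (fun a b => θ * Real.exp (-(δK * g.dist a b))))
    (hA : HasMajorant (g := toB6 g R₀ H₀) blk A (fun a b => B' * g.len a ^ 2 * Real.exp (-(ρA * g.dist a b))))
    (hfix : A = G0 + G0 ∘ₗ T ∘ₗ A) :
    HasMajorant (g := toB6 g R₀ H₀) blk (A - G0) (fun a b => θ * B' * c * g.len a ^ 2 * Real.exp (-(ρ * g.dist a b))) := by
  have hsub : A - G0 = (G0 ∘ₗ T) ∘ₗ A := by
    conv_lhs => rw [hfix]
    rw [add_sub_cancel_left, LinearMap.comp_assoc]
  rw [hsub]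
  exact hasMajorant_G0TA_of_step hG hrow hθ hB' hρ hρA hρδ hK hA

end OneMember

/-! ## §2 ★ The family: majorants of `G_D − G₀` and `G₁ − G₀` carrying `Mα₀`, from ROW 20's displayed inputs at the pins -/

section Linear

open Node00 (IBondY FBondY CfgY BondOpY BondParY QGQOfY QY QsY)
open B6KLevelCensusIndexV1 (KIdx)
open B9Eq3132RingInverseReading (reMatY normMatY)

variable {κ : Type} [Fintype κ] [DecidableEq κ]
variable {d ℓ : ℕ} {hd : 1 ≤ d + 1} {hL : Odd (ℓ + 1) ∧ 1 < ℓ + 1} {b₀ b₁ : ℝ}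
variable [CompleteSpace 𝔸] [FiniteDimensional ℝ 𝔸]

omit [DecidableEq κ] in
/-- the coordinate model is additive in the letter: `GcoK … (T − T₀) U = GcoK … T U − GcoK … T₀ U`. [cite: Balaban1985BackgroundPropagators, (3.42) p.397, bookkeeping] -/
theorem GcoK_sub (i : KIdx d ℓ hd hL b₀ b₁) (b : Module.Basis κ ℝ 𝔸) (B : B9.Backgrounds) (cfg : B.Cfg → CfgY 𝔸 i) (T T₀ : BondOpY 𝔸 i)
    (U₁ : B.Cfg) : GcoK i b B cfg (T - T₀) U₁ = GcoK i b B cfg T U₁ - GcoK i b B cfg T₀ U₁ := by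
  refine LinearMap.ext fun f => funext fun p => ?_
  simp only [GcoK, LinearMap.smul_apply, LinearMap.sub_apply, Pi.smul_apply, Pi.sub_apply, coordOpK_apply,
    LinearMap.restrictScalars_apply, map_sub, Finsupp.coe_sub, smul_eq_mul, mul_sub]

omit [FiniteDimensional ℝ 𝔸] in
/-- `Q(U)G(U)Q*(U)` is additive in the letter `G`. [cite: Balaban1985BackgroundPropagators, (3.132) p.422, bookkeeping] -/
theorem QGQOfY_sub (i : KIdx d ℓ hd hL b₀ b₁) (parB : BondParY 𝔸 i) (T T₀ : BondOpY 𝔸 i) (U : CfgY 𝔸 i) :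
    QGQOfY i parB (T - T₀) U = QGQOfY i parB T U - QGQOfY i parB T₀ U := by
  simp only [QGQOfY, Pi.sub_apply, LinearMap.sub_comp, LinearMap.comp_sub]

omit [CompleteSpace 𝔸] [FiniteDimensional ℝ 𝔸] in
/-- the normalised real matrix is additive in the letter. [cite: Balaban1985BackgroundPropagators, (3.132) p.422, bookkeeping] -/
theorem normMatY_sub {X Ff : Type} [Fintype X] [DecidableEq X] [Fintype Ff] [DecidableEq Ff] (b : Module.Basis Ff ℝ 𝔸) (w : X → ℝ)
    (T T' : Module.End ℂ (X → 𝔸)) : normMatY b w (T - T') = normMatY b w T - normMatY b w T' := by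
  unfold normMatY reMatY
  rw [sub_eq_add_neg, LinearMap.restrictScalars_add, LinearMap.restrictScalars_neg, ← sub_eq_add_neg, map_sub,
    Matrix.mul_sub, Matrix.sub_mul]

end Linear

section FromStepFamily

open Node00 (IBondY FBondY CfgY BondOpY BondParY QGQOfY)
open B6KLevelCensusIndexV1 (KIdx)
open B6GlobalChartV1 (blkV1)
open B9Thm34Ext (toB6)
open B9Thm312Whole (Ops Thm33G0 Step FormSmall Identities GeoOK)
open B9Thm312WholeLeaf (fix_of_inverses)
open B11SectG (RowSum)
open B9PinMembersKLevelV1 (MemberY geo9Y bg9Y)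
open B9GeoLemma21KLevelV1 (geo9K_len_pos rowSum261_geo9Y)

variable {κ : Type} [Fintype κ] [DecidableEq κ]
variable {d ℓ : ℕ} {hd : 1 ≤ d + 1} {hL : Odd (ℓ + 1) ∧ 1 < ℓ + 1} {b₀ b₁ : ℝ} {Mstar : ℕ}
variable [CompleteSpace 𝔸] [FiniteDimensional ℝ 𝔸] {G : Subgroup 𝔸ˣ}
variable {Y Z W : MemberY d ℓ hd hL b₀ b₁ Mstar → Type} [∀ x, Fintype (Z x)] [∀ x, Fintype (W x)]

/-- a small product: `0 ≤ t`, `m ≤ (2(t+1))⁻¹` ⇒ `t·m ≤ ½`. [folklore] -/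
private theorem small_aux {t m : ℝ} (ht : 0 ≤ t) (hm : m ≤ (2 * (t + 1))⁻¹) : t * m ≤ 1 / 2 := by
  have h1 : t * m ≤ t * (2 * (t + 1))⁻¹ := mul_le_mul_of_nonneg_left hm ht
  have h2 : t * (2 * (t + 1))⁻¹ ≤ 1 / 2 := by
    rw [← div_eq_mul_inv, div_le_iff₀ (by positivity)]
    nlinarith
  exact h1.trans h2

omit [DecidableEq κ] in
/-- ★ **THE FAMILY OF DIFFERENCE MAJORANTS FROM ROW 20's DISPLAYED INPUTS**: at the coordinate pins (`blk = blkBK bI`, `G U = GcoK … (T x) U`, `G1 U = GcoK … (T₁ x) U`,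
and `G0 U = GcoK … (T₀ x) U` — row 20's `G₀` IS the genuine Sect. A–C letter), Theorem 3.3 for `G₀` + the 𝔠⁽²⁾ step with constant `θ₁·(Mα₀)` + the identities (the
certificate's `hmodel` 5-conjunct shape) and [4] (2.61) for the record geometry give, above `max(M₁, M_L)` and for `Mα₀ ≤ min(a₁, (2(θ₁c+1))⁻¹)`, the [4]-(2.51)
majorants `(2B₀cθ₁)·(Mα₀)·(Lʲη)²e^{−ρd}` of the coordinate models of `T − T₀ = G_D − G₀` AND `T₁ − T₀ = G₁ − G₀` — the small factor `Mα₀` EXPLICIT.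
[cite: Balaban1985BackgroundPropagators, Thm 3.12 p.423, (3.130)–(3.131) pp.421–422, (3.137)–(3.138) p.423; Balaban1984PropagatorsII, (2.51) p.232, Lemma 2.1 (2.61) p.234] -/
theorem subMajorants_of_step12 [∀ x : MemberY d ℓ hd hL b₀ b₁ Mstar, Fintype (geo9Y x).Site] (bK : Module.Basis κ ℝ 𝔸) {c35 : ℝ}
    (𝔬 : ∀ x : MemberY d ℓ hd hL b₀ b₁ Mstar, Ops (geo9Y x) (bg9Y 𝔸 G x) (XBK κ x.toKIdx) (Y x) (Z x) (W x))
    (H₀ : MemberY d ℓ hd hL b₀ b₁ Mstar → Prop) (T T₁ T₀ : ∀ x : MemberY d ℓ hd hL b₀ b₁ Mstar, BondOpY 𝔸 x.toKIdx)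
    {bI : ∀ x : MemberY d ℓ hd hL b₀ b₁ Mstar, FBondY x.toKIdx → IBondY x.toKIdx}
    (hblk : ∀ x, (𝔬 x).blk = blkBK x.toKIdx (bI x))
    (hGco : ∀ (x : MemberY d ℓ hd hL b₀ b₁ Mstar) (U : (bg9Y 𝔸 G x).Cfg), (𝔬 x).G U = GcoK x.toKIdx bK (bg9Y 𝔸 G x) (fun U => U) (T x) U)
    (hG1co : ∀ (x : MemberY d ℓ hd hL b₀ b₁ Mstar) (U : (bg9Y 𝔸 G x).Cfg), (𝔬 x).G1 U = GcoK x.toKIdx bK (bg9Y 𝔸 G x) (fun U => U) (T₁ x) U)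
    (hG0co : ∀ (x : MemberY d ℓ hd hL b₀ b₁ Mstar) (U : (bg9Y 𝔸 G x).Cfg), (𝔬 x).G0 U = GcoK x.toKIdx bK (bg9Y 𝔸 G x) (fun U => U) (T₀ x) U)
    (θ₁ r₁ B₀ δ₀ δK σ ρ a₁ M₁ : ℝ) (hθ₁ : 0 ≤ θ₁) (hB₀ : 0 ≤ B₀) (hσ : 0 < σ) (hρ : 0 < ρ) (hρS : ρ ≤ δ₀) (hρδ : ρ + σ ≤ δK)
    (ha₁ : 0 < a₁) (hM₁ : 0 < M₁) (hgeo : ∀ x : MemberY d ℓ hd hL b₀ b₁ Mstar, GeoOK (geo9Y x))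
    (hmodel : ∀ x : MemberY d ℓ hd hL b₀ b₁ Mstar, M₁ ≤ (geo9Y x).M → ∀ α₀ : ℝ, 0 < α₀ → (geo9Y x).M * α₀ ≤ a₁ →
      ∀ U : (bg9Y 𝔸 G x).Cfg, (bg9Y 𝔸 G x).Reg335 c35 α₀ U → (bg9Y 𝔸 G x).Reg336 c35 α₀ U →
        Thm33G0 (𝔬 x) 1 (H₀ x) B₀ δ₀ U ∧
        Step (𝔬 x) 1 (H₀ x) (hgeo x).lenle 1 (θ₁ * ((geo9Y x).M * α₀)) δK U ∧
        Step (𝔬 x) 1 (H₀ x) (hgeo x).lenle 2 (θ₁ * ((geo9Y x).M * α₀)) δK U ∧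
        FormSmall (𝔬 x) (r₁ * ((geo9Y x).M * α₀)) U ∧ Identities (𝔬 x) U) :
    ∃ M₂ a₂ C δ : ℝ, 0 < M₂ ∧ 0 < a₂ ∧ 0 ≤ C ∧ 0 < δ ∧
      ∀ x : MemberY d ℓ hd hL b₀ b₁ Mstar, M₂ ≤ (geo9Y x).M → ∀ α₀ : ℝ, 0 < α₀ → (geo9Y x).M * α₀ ≤ a₂ →
        ∀ U : (bg9Y 𝔸 G x).Cfg, (bg9Y 𝔸 G x).Reg335 c35 α₀ U → (bg9Y 𝔸 G x).Reg336 c35 α₀ U →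
          HasMajorant (g := toB6 (geo9Y x) 1 (H₀ x)) (blkBK x.toKIdx (bI x)) (GcoK x.toKIdx bK (bg9Y 𝔸 G x) (fun U => U) (T x - T₀ x) U)
              (fun a a' => C * ((geo9Y x).M * α₀) * (geo9Y x).len a ^ 2 * Real.exp (-(δ * (geo9Y x).dist a a'))) ∧
            HasMajorant (g := toB6 (geo9Y x) 1 (H₀ x)) (blkBK x.toKIdx (bI x)) (GcoK x.toKIdx bK (bg9Y 𝔸 G x) (fun U => U) (T₁ x - T₀ x) U)
              (fun a a' => C * ((geo9Y x).M * α₀) * (geo9Y x).len a ^ 2 * Real.exp (-(δ * (geo9Y x).dist a a'))) := by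
  -- (2.61) for the record geometry at rate σ, constant `max c 0`
  obtain ⟨ML, c, hrow0⟩ := rowSum261_geo9Y (d := d) (ℓ := ℓ) (hd := hd) (hL := hL) (b₀ := b₀) (b₁ := b₁) (Mstar := Mstar) σ hσ
  set c' : ℝ := max c 0 with hc'
  have hc'0 : 0 ≤ c' := le_max_right _ _
  have hrow : ∀ x : MemberY d ℓ hd hL b₀ b₁ Mstar, ML ≤ (geo9Y x).M → RowSum (toB6 (geo9Y x) 1 (H₀ x)) σ c' :=
    fun x hM y => (hrow0 x hM y).trans (le_max_left _ _)
  set a₂ : ℝ := min a₁ (2 * (θ₁ * c' + 1))⁻¹ with ha₂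
  have ha₂0 : 0 < a₂ := lt_min ha₁ (inv_pos.2 (by positivity))
  refine ⟨max M₁ ML, a₂, 2 * B₀ * c' * θ₁, ρ, lt_of_lt_of_le hM₁ (le_max_left _ _), ha₂0, by positivity, hρ, fun x hM α₀ hα₀ hMa U hU hU' => ?_⟩
  have hM1 : M₁ ≤ (geo9Y x).M := (le_max_left _ _).trans hM
  have hMLx : ML ≤ (geo9Y x).M := (le_max_right _ _).trans hM
  have hMa1 : (geo9Y x).M * α₀ ≤ a₁ := hMa.trans (min_le_left _ _)
  obtain ⟨h33, _, hst, _, hI⟩ := hmodel x hM1 α₀ hα₀ hMa1 U hU hU'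
  have hMα0 : 0 ≤ (geo9Y x).M * α₀ := mul_nonneg (hM₁.le.trans hM1) hα₀.le
  have hsmall : θ₁ * ((geo9Y x).M * α₀) * c' ≤ 1 / 2 := by
    have h := small_aux (t := θ₁ * c') (m := (geo9Y x).M * α₀) (by positivity) (hMa.trans (min_le_right _ _))
    calc θ₁ * ((geo9Y x).M * α₀) * c' = θ₁ * c' * ((geo9Y x).M * α₀) := by ring
      _ ≤ 1 / 2 := h
  have hq : θ₁ * ((geo9Y x).M * α₀) * c' < 1 := lt_of_le_of_lt hsmall (by norm_num)
  have hθ : 0 ≤ θ₁ * ((geo9Y x).M * α₀) := mul_nonneg hθ₁ hMα0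
  -- the majorants of `G`, `G₁` themselves (n06-l `entry0_of_step`, constant `B₀(1 − q)⁻¹`)
  obtain ⟨hGm, hG1m⟩ := hasMajorant_G_G1_of_step (hgeo x) (𝔬 x) (hrow x hMLx) hθ hB₀ hρ.le hρS hρδ hq h33 hst hI
  have hq1 : 0 ≤ (1 - θ₁ * ((geo9Y x).M * α₀) * c')⁻¹ := inv_nonneg.mpr (by linarith)
  have hB' : 0 ≤ B₀ * (1 - θ₁ * ((geo9Y x).M * α₀) * c')⁻¹ := mul_nonneg hB₀ hq1
  -- the differences through the resolvent identities
  have hD := hasMajorant_sub_of_fix (hgeo x) (hrow x hMLx) hθ hB' hρ.le le_rfl hρδ hst.step hGm (fix_of_inverses hI.invG0' hI.invG)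
  have hD1 := hasMajorant_sub_of_fix (hgeo x) (hrow x hMLx) hθ hB' hρ.le le_rfl hρδ hst.step1 hG1m (fix_of_inverses hI.invG0' hI.invG1)
  -- the constant `θ₁(Mα₀)·B₀(1 − q)⁻¹·c′ ≤ (2B₀c′θ₁)·(Mα₀)`
  have hinv : (1 - θ₁ * ((geo9Y x).M * α₀) * c')⁻¹ ≤ 2 := by
    rw [inv_le_comm₀ (by linarith) (by norm_num)]
    linarith
  have hle : ∀ a a' : (geo9Y x).Site,
      θ₁ * ((geo9Y x).M * α₀) * (B₀ * (1 - θ₁ * ((geo9Y x).M * α₀) * c')⁻¹) * c' * (geo9Y x).len a ^ 2 * Real.exp (-(ρ * (geo9Y x).dist a a')) ≤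
        2 * B₀ * c' * θ₁ * ((geo9Y x).M * α₀) * (geo9Y x).len a ^ 2 * Real.exp (-(ρ * (geo9Y x).dist a a')) := by
    intro a a'
    have h0 : 0 ≤ (geo9Y x).len a ^ 2 * Real.exp (-(ρ * (geo9Y x).dist a a')) := by positivity
    have h1 : θ₁ * ((geo9Y x).M * α₀) * (B₀ * (1 - θ₁ * ((geo9Y x).M * α₀) * c')⁻¹) * c' ≤ 2 * B₀ * c' * θ₁ * ((geo9Y x).M * α₀) := by
      have h2 : B₀ * (1 - θ₁ * ((geo9Y x).M * α₀) * c')⁻¹ ≤ B₀ * 2 := mul_le_mul_of_nonneg_left hinv hB₀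
      calc θ₁ * ((geo9Y x).M * α₀) * (B₀ * (1 - θ₁ * ((geo9Y x).M * α₀) * c')⁻¹) * c'
          = (θ₁ * ((geo9Y x).M * α₀) * c') * (B₀ * (1 - θ₁ * ((geo9Y x).M * α₀) * c')⁻¹) := by ring
        _ ≤ (θ₁ * ((geo9Y x).M * α₀) * c') * (B₀ * 2) := mul_le_mul_of_nonneg_left h2 (by positivity)
        _ = 2 * B₀ * c' * θ₁ * ((geo9Y x).M * α₀) := by ring
    calc _ = (θ₁ * ((geo9Y x).M * α₀) * (B₀ * (1 - θ₁ * ((geo9Y x).M * α₀) * c')⁻¹) * c') *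
          ((geo9Y x).len a ^ 2 * Real.exp (-(ρ * (geo9Y x).dist a a'))) := by ring
      _ ≤ (2 * B₀ * c' * θ₁ * ((geo9Y x).M * α₀)) * ((geo9Y x).len a ^ 2 * Real.exp (-(ρ * (geo9Y x).dist a a'))) :=
          mul_le_mul_of_nonneg_right h1 h0
      _ = _ := by ring
  rw [hblk x] at hD hD1
  rw [hGco x U, hG0co x U, ← GcoK_sub] at hD
  rw [hG1co x U, hG0co x U, ← GcoK_sub] at hD1
  exact ⟨hasMajorant_mono (g := toB6 (geo9Y x) 1 (H₀ x)) _ hD hle, hasMajorant_mono (g := toB6 (geo9Y x) 1 (H₀ x)) _ hD1 hle⟩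

end FromStepFamily

/-! ## §4 One member, one configuration: the normalised entry from a block majorant, EXPLICIT constant ((2.142) at `U` + (2.60)) -/

section Entry

open Node00 (IBondY FBondY CfgY BondOpY BondParY deltaY QGQOfY)
open B6KLevelCensusIndexV1 (KIdx)
open B6GlobalChartV1 (blkV1)
open B9Thm34Ext (toB6)
open B9GeoNormsKLevelV1 (geo9K)
open B9GeoLemma21KLevelV1 (geo9K_len_pos geo9K_one_le_L)
open B9RWSumsReadsNbr (nbr)
open B9Eq3132RingInverseReading (normMatY dimConstY' dimConstY'_pos)
open B9Eq3132NuReading (lamInvY lamInvY_pos)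

variable {κ : Type} [Fintype κ] [DecidableEq κ] {Ff : Type} [Fintype Ff] [DecidableEq Ff]
variable {d ℓ : ℕ} {hd : 1 ≤ d + 1} {hL : Odd (ℓ + 1) ∧ 1 < ℓ + 1} {b₀ b₁ : ℝ}
variable [CompleteSpace 𝔸] [FiniteDimensional ℝ 𝔸]

/-- **THE NORMALISED ENTRY FROM A BLOCK MAJORANT** (one member, one `U`, explicit constant): if the coordinate model of a bond-sector letter `T` has the
[4]-(2.51) majorant `C(Lʲη)²e^{−δd}` w.r.t. a level-∕1-faithful block map, the bond transporters are contractive and the radius-`(ℓ+4)` count is `mN`, then above the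
(2.60) threshold `(d+3)log L ≤ δ(2L²−1)M`: `|diag(Λ⁻¹∕κ′)·reMatY(Q_U T(U) Q*_U)·diag(Λ⁻¹) (y,f) (y′,f′)| ≤ (Σ_f‖b_f‖)(‖repr_b‖∕κ′)(mN·e^{2δ(ℓ+4)})L^{(d+3)∕2}·C·e^{−(δ∕2)d(y,y′)}` — LINEAR in `C`.
[cite: Balaban1985BackgroundPropagators, (3.132) p.422; Balaban1984PropagatorsII, (2.142) p.248, (2.149) p.249, Lemma 2.1 (2.60) p.234] -/
theorem abs_normMatY_QGQOfY_le_of_hasMajorant (i : KIdx d ℓ hd hL b₀ b₁) [instF : Fintype (geo9K i).Site] [instD : DecidableEq (geo9K i).Site]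
    (bK : Module.Basis κ ℝ 𝔸)
    (b : Module.Basis Ff ℝ 𝔸) {B : B9.Backgrounds} (cfg : B.Cfg → CfgY 𝔸 i) (T : BondOpY 𝔸 i) (parB : BondParY 𝔸 i) (U₁ : B.Cfg)
    {bI : FBondY i → IBondY i}
    (hlev : ∀ f : FBondY i, lvl i.hN i.D i.hk (bI f) = (blkV1 i.hN i.D f).1.1)
    (hβ1 : ∀ f : FBondY i, (B6Geom246MultiLevelTorus.geomT i.D).dist (β i.hN i.D i.hk (bI f)) (blkV1 i.hN i.D f) ≤ 1)
    {mN : ℕ} (hnbr : ∀ y : (geo9K i).Site, (nbr (geo9K i) ((ℓ : ℝ) + 4) y).card ≤ mN)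
    (hpar : ∀ s s', ‖(parB (cfg U₁) s s' : 𝔸)‖ ≤ 1 ∧ ‖(((parB (cfg U₁) s s')⁻¹ : 𝔸ˣ) : 𝔸)‖ ≤ 1)
    {R : ℝ} {H : Prop} {C δ : ℝ} (hC : 0 ≤ C) (hδ : 0 < δ)
    (hM : ((d : ℝ) + 3) * Real.log (geo9K i).L ≤ δ * (2 * ((ℓ : ℝ) + 1) ^ 2 - 1) * (geo9K i).M)
    (h0 : HasMajorant (g := toB6 (geo9K i) R H) (blkBK i bI) (GcoK i bK B cfg T U₁)
      (fun a a' => C * (geo9K i).len a ^ 2 * Real.exp (-(δ * (geo9K i).dist a a'))))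
    (a c : (geo9K i).Site × Ff) :
    |normMatY (X := (geo9K i).Site) b (lamInvY i) (QGQOfY i parB T (cfg U₁)) a c| ≤
      basisBound39 b * (‖(b.equivFunL : 𝔸 →L[ℝ] (Ff → ℝ))‖ / dimConstY' b) * (mN * Real.exp (2 * (δ * ((ℓ : ℝ) + 4)))) *
        (((ℓ + 1 : ℕ) : ℝ)) ^ (((d : ℝ) + 3) / 2) * C * Real.exp (-(δ / 2 * (geo9K i).dist a.1 c.1)) := by
  have h2142 := norm_QGQOfY_deltaY_le (κ := κ) i bK cfg T parB U₁ hlev hβ1 hnbr hpar hC hδ.le h0 a.1 c.1 (b c.2)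
  have h4 := abs_normMatY_le (X := (geo9K i).Site) b (fun y => (lamInvY_pos i y).le) (QGQOfY i parB T (cfg U₁)) a c
  have h5 := levelFactor_le i hδ hM a.1 c.1
  have hκ := dimConstY'_pos b
  have hrepr : 0 ≤ ‖(b.equivFunL : 𝔸 →L[ℝ] (Ff → ℝ))‖ / dimConstY' b := div_nonneg (norm_nonneg _) hκ.le
  have hbb0 : 0 ≤ basisBound39 b := Finset.sum_nonneg fun _ _ => norm_nonneg _
  have hbf : ‖b c.2‖ ≤ basisBound39 b := norm_basis_le b c.2
  have hLx : (geo9K i).L = ((ℓ + 1 : ℕ) : ℝ) := rfl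
  rw [hLx] at h5
  have s12 := h4.trans (mul_le_mul_of_nonneg_left h2142
    (mul_nonneg (mul_nonneg (lamInvY_pos i a.1).le (lamInvY_pos i c.1).le) hrepr))
  generalize hΛa : lamInvY i a.1 = Λa at h5 s12
  generalize hΛc : lamInvY i c.1 = Λc at h5 s12
  generalize hla : (geo9K i).len a.1 = la at s12 h5
  generalize hpw : ((((ℓ + 1 : ℕ) : ℝ) ^ (d + 1)) ^ (lvl i.hN i.D i.hk c.1))⁻¹ = pw at s12 h5
  generalize hD : (geo9K i).dist a.1 c.1 = D at s12 h5 ⊢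
  generalize hr : ‖(b.equivFunL : 𝔸 →L[ℝ] (Ff → ℝ))‖ / dimConstY' b = r at s12 hrepr ⊢
  generalize hK : (mN : ℝ) * C * Real.exp (2 * (δ * ((ℓ : ℝ) + 4))) = K at s12 ⊢
  generalize hnb : ‖b c.2‖ = nb at s12 hbf
  generalize hLB : (((ℓ + 1 : ℕ) : ℝ)) ^ (((d : ℝ) + 3) / 2) = LB at h5 ⊢
  have hK0 : 0 ≤ K := by rw [← hK]; positivity
  have hΛa0 : 0 ≤ Λa := by rw [← hΛa]; exact (lamInvY_pos _ _).le
  have hΛc0 : 0 ≤ Λc := by rw [← hΛc]; exact (lamInvY_pos _ _).le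
  have hpw0 : 0 ≤ pw := by rw [← hpw]; positivity
  have s3 : Λa * Λc * r * (K * la ^ 2 * pw * Real.exp (-(δ * D)) * nb) = r * K * nb * (Λa * Λc * la ^ 2 * pw) * Real.exp (-(δ * D)) := by ring
  have s4 : r * K * nb * (Λa * Λc * la ^ 2 * pw) * Real.exp (-(δ * D)) ≤ r * K * basisBound39 b * (LB * Real.exp (δ / 2 * D)) * Real.exp (-(δ * D)) := by
    refine mul_le_mul_of_nonneg_right ?_ (Real.exp_nonneg _)
    exact mul_le_mul (mul_le_mul_of_nonneg_left hbf (mul_nonneg hrepr hK0)) h5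
      (mul_nonneg (mul_nonneg (mul_nonneg hΛa0 hΛc0) (sq_nonneg _)) hpw0) (mul_nonneg (mul_nonneg hrepr hK0) hbb0)
  have s5 : r * K * basisBound39 b * (LB * Real.exp (δ / 2 * D)) * Real.exp (-(δ * D)) =
      basisBound39 b * r * (mN * Real.exp (2 * (δ * ((ℓ : ℝ) + 4)))) * LB * C * Real.exp (-(δ / 2 * D)) := by
    rw [show Real.exp (-(δ / 2 * D)) = Real.exp (δ / 2 * D) * Real.exp (-(δ * D)) by
      rw [← Real.exp_add]; congr 1; ring, ← hK]
    ring
  exact s12.trans (s3.le.trans (s4.trans s5.le))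

end Entry

end Literature.MathematicalPhysics.QuantumFieldTheory.Balaban1983to89.B9Eq3132StepDifference

end
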